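import Literature.Analysis.FluidPDE.QuasiSelfSimilarMoveSP05
import HarnessLib

/-!
# Straight move, phase 5: re-description certificates towards phase 6

Topic `Literature/Analysis/FluidPDE`. Emitted data / kernel certificates of the explicit straight generating
move (`S`) in the typed-chain model, under the contract of `PlanarGeneratorAssembly.lean`
(`acm_compatible_blocks_of_slots`). Generated by the author's emitter from the exact rational design;
no named facts, every theorem is decided in the kernel or assembled from decided chunks. [folklore]

## References

* G. Alberti, G. Crippa, A. L. Mazzucato, *Exponential self-similar mixing by incompressible
  flows*, J. Amer. Math. Soc. 32 (2019), 445–490, §8 (arXiv:1605.02090).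
-/

noncomputable section

namespace Literature.Analysis.FluidPDE.QuasiSelfSimilar.MoveS

open PlanarKinematics QuasiSelfSimilar

/-- Cover certificate of the end keyframe of phase 5 by the start keyframe of phase 6. [folklore] -/
def rc05 : List (Fin 2 × List (ℕ × EquivCert)) := [(0, [(0, .same)]), (0, [(1, .same)]), (0, [(2, .same)]), (0, [(3, .same)]), (0, [(4, .same)]), (1, [(5, .same)]), (1, [(6, .same)]), (1, [(7, .same)]), (0, [(8, .same)]), (0, [(9, .same)]), (0, [(10, .same)]), (0, [(11, .same)]), (0, [(12, .same)]), (1, [(13, .same)]), (1, [(14, .same)]), (1, [(15, .same)]), (0, [(17, (.gap 1 0 0 0 (mkRat (-3709) 9000) (mkRat (-3671) 9000))), (16, .same)]), (0, [(18, .flip), (17, (.gap 0 0 0 0 (mkRat (-3673) 9000) (mkRat (-727) 1800)))]), (1, [(19, .same)]), (0, [(20, .same)]), (0, [(21, .same)]), (0, [(22, .same)]), (0, [(23, .same)]), (0, [(24, .same)]), (1, [(25, .same)]), (0, [(27, (.gap 1 0 0 0 (mkRat (-1073) 1800) (mkRat (-5327) 9000))), (26, .same)]), (0, [(28, .flip),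 (27, (.gap 0 0 0 0 (mkRat (-5329) 9000) (mkRat (-5291) 9000)))]), (1, [(29, .same)]), (1, [(30, .same)]), (1, [(31, .same)]), (0, [(32, .same)]), (0, [(33, .same)]), (0, [(34, .same)]), (0, [(35, .same)]), (0, [(36, .same)]), (1, [(37, .same)]), (1, [(38, .same)]), (1, [(39, .same)]), (0, [(40, .same)]), (0, [(41, .same)]), (0, [(42, .same)]), (0, [(43, .same)]), (0, [(44, .same)])]

/-- Cover certificate of the start keyframe of phase 6 by the end keyframe of phase 5. [folklore] -/
def rc05' : List (Fin 2 × List (ℕ × EquivCert)) := [(0, [(0, .same)]), (0, [(1, .same)]), (0, [(2, .same)]), (0, [(3, .same)]), (0, [(4, .same)]), (1, [(5, .same)]), (1, [(6, .same)]), (1, [(7, .same)]), (0, [(8, .same)]), (0, [(9, .same)]), (0, [(10, .same)]), (0, [(11, .same)]), (0, [(12, .same)]), (1, [(13, .same)]), (1, [(14, .same)]), (1, [(15, .same)]), (0, [(16, .same)]), (0, [(17, (.gap 0 0 0 0 (mkRat (-4541) 4500) (mkRat (-4513) 4500))), (16, (.gap 0 0 1 0 (mkRat (-4559) 4500) (mkRat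 (-4531) 4500)))]), (0, [(17, .flip)]), (1, [(18, .same)]), (0, [(19, .same)]), (0, [(20, .same)]), (0, [(21, .same)]), (0, [(22, .same)]), (0, [(23, .same)]), (1, [(24, .same)]), (0, [(25, .same)]), (0, [(26, (.gap 0 0 0 0 (mkRat (-4469) 4500) (mkRat (-4441) 4500))), (25, (.gap 0 0 1 0 (mkRat (-4487) 4500) (mkRat (-4459) 4500)))]), (0, [(26, .flip)]), (1, [(27, .same)]), (1, [(28, .same)]), (1, [(29, .same)]), (0, [(30, .same)]), (0, [(31, .same)]), (0, [(32, .same)]), (0, [(33, .same)]), (0, [(34, .same)]), (1, [(35, .same)]), (1, [(36, .same)]), (1, [(37, .same)]), (0, [(38, .same)]), (0, [(39, .same)]), (0, [(40, .same)]), (0, [(41, .same)]), (0, [(42, .same)])]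

end Literature.Analysis.FluidPDE.QuasiSelfSimilar.MoveS

end
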